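import Literature.Probability.RandomPlanarGeometry.TwoSidedWholePlaneSLEStationarity
import HarnessLib

/-!
# Stationary increments ⟺ shift invariance of the Lebesgue-unrooted measure (Zhan (2021), proof of Cor. 4.7)

Topic `Probability/RandomPlanarGeometry`; second sequel to `TwoSidedWholePlaneSLE` (after
`TwoSidedWholePlaneSLEStationarity`), towards Zhan's Corollary 4.7 (stationary increments of the
Minkowski content parametrisation `γ̂₀` of the two-sided whole-plane SLE_κ loop through `0`).

Proved here, at the level of laws on two-sided paths `C(ℝ, ℂ)` and for every s-finite measure (nothing
is specific to SLE), is the **un-rooting argument** of the printed proof of Cor. 4.7 — its last two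
paragraphs and the sentence before them. Read in the natural parametrisation based at the marked
point, the objects of that proof are:

* `ℛ_Γ(γ, z) = (z + γ, z)` with "`ν^#_{∞⇌z} = z + ν^#_{∞⇌0}`": the measure `ν^#_{∞⇌z}(dγ) ⊗ m²(dz)`
  becomes the **Lebesgue smear** `lebesgueSmear μ := (μ ⊗ m²).map ((γ, z) ↦ z + γ)` of the law
  `μ = ν̂^#` (a σ-finite measure on parametrised paths with a Lebesgue-distributed root);
* `𝒯_* : (γ, z) ↦ (γ, 𝒯_γ z)` (move the marked point by natural length `1`) becomes the **time
  shift** `timeShiftPath 1 : γ̃ ↦ γ̃(1 + ·)`, and `μ¹_∞(dγ) ⊗ ℳ_γ(dz)` (rooted SLE loop measure marked by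
  its Minkowski content measure; Rem. 2.4: `ℳ_γ = 𝒫(γ)_* Leb`) becomes the **time smear**
  `timeSmear M := (M ⊗ Leb_ℝ).map ((γ, t) ↦ γ(t + ·))` of `M = 𝒫_* μ¹_∞`, which is shift invariant
  for every `M` (`timeSmear_map_timeShiftPath` — Zhan's "`ℳ_γ` is invariant under `𝒯_γ`");
* the conclusion "`ν^#_{∞⇌0} ⊗ m²` is invariant under `ℛ_Γ⁻¹ ∘ 𝒯_* ∘ ℛ_Γ ∘ ℛ_ℂ : (γ, z) ↦
  (γ - 𝒫(γ)(1), z)`, therefore `ν̂^#` is invariant under `𝒯₁ : γ̂ ↦ γ̂(· + 1) - γ̂(1)`" becomes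
  `map_reroot_eq_self_iff_lebesgueSmear`: **for a law `μ` carried by paths rooted at `0`,
  `μ.map (reroot s) = μ` iff `lebesgueSmear μ` is invariant under `timeShiftPath s`** — via
  `timeShiftPath s (z + γ) = (z + γ(s)) + reroot s γ` (`timeShiftPath_translatePath`), the shear
  `ℛ_ℂ : (γ, z) ↦ (reroot s γ, z + γ(s))` transporting `μ ⊗ m²` to `(reroot s)_* μ ⊗ m²`
  (`measurePreserving_rerootShear`, translation invariance of `m²`), whence
  `(lebesgueSmear μ).map (timeShiftPath s) = lebesgueSmear (μ.map (reroot s))`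
  (`lebesgueSmear_map_timeShiftPath`), and injectivity of the smear on rooted laws (`ℛ_Γ⁻¹`:
  `prod_volume_eq_lebesgueSmear_map`, `eq_of_prod_volume_eq`).

Consequently (`isRerootInvariant_of_lebesgueSmear_eq_timeSmear`,
`IsTwoSidedWholePlaneSLENatLawMeas.isRerootInvariant_of_timeSmear`) the corrected Cor. 4.7 — every
`IsTwoSidedWholePlaneSLENatLawMeas κ` law is `reroot s`-invariant for all `s` — follows from the single
identity `lebesgueSmear ν̂^# = timeSmear (𝒫_* μ¹_∞)`, which is Zhan (2021), Thm 4.1 (iv)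
(`μ¹_∞(dγ) ⊗ ℳ_γ(dz) = ν^#_{∞⇌z}(dγ) ⊗ m²(dz)`) with Rem. 2.4 and Lemma 2.12, read in the natural
parametrisation; the rooted SLE loop measure `μ¹_∞` is not constructed in the tree, so that identity
stays a hypothesis here (for every `s` at once, so the self-similarity reduction of Step 1,
`isRerootInvariant_of_isSelfSimilar_of_map_reroot_one`, is not even needed on this road).

## References

* D. Zhan, *SLE loop measures*, PTRF 179 (2021), arXiv:1702.08026: proof of Cor. 4.7 (last two
  paragraphs; maps `ℛ_Γ`, `𝒯_*`, `ℛ_ℂ`), Thm 4.1 (iv) (rooted loop measure `μ¹_∞`; the theorem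
  headed "Rooted loops", numbered 4.1 in the arXiv version), Rem. 2.4, Lemma 2.12. [Zhan2021SLELoopMeasures]
-/

noncomputable section

open Set Filter Topology MeasureTheory ProbabilityTheory Complex
open Literature.Probability.RandomPlanarGeometry.RootedCurve (reroot reroot_apply reroot_reroot)
open scoped NNReal Real ENNReal

namespace Literature.Probability.RandomPlanarGeometry

open scoped PathBorel

/-! ### Time shift and space translation of two-sided paths -/

section PathMaps

/-- **Time shift** of a two-sided path, `timeShiftPath s γ = γ(s + ·)` — Zhan's `𝒯_*` (moving the marked
point along the curve by natural length `s`) read in the parametrisation based at the marked point.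
[cite: Zhan2021SLELoopMeasures, proof of Cor. 4.7] -/
def timeShiftPath (s : ℝ) (γ : C(ℝ, ℂ)) : C(ℝ, ℂ) where
  toFun t := γ (s + t)
  continuous_toFun := γ.continuous.comp (continuous_const.add continuous_id)

/-- Value of a shifted path. [folklore] -/
@[simp] theorem timeShiftPath_apply (s : ℝ) (γ : C(ℝ, ℂ)) (t : ℝ) : timeShiftPath s γ t = γ (s + t) := rfl

/-- Shifting by `0` is the identity. [folklore] -/
@[simp] theorem timeShiftPath_zero (γ : C(ℝ, ℂ)) : timeShiftPath 0 γ = γ := by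
  ext t; simp

/-- Time shifts compose additively: `timeShiftPath s (timeShiftPath s' γ) = timeShiftPath (s' + s) γ`. [folklore] -/
theorem timeShiftPath_timeShiftPath (s s' : ℝ) (γ : C(ℝ, ℂ)) :
    timeShiftPath s (timeShiftPath s' γ) = timeShiftPath (s' + s) γ := by
  ext t; simp [add_assoc]

/-- The time shift is continuous on `C(ℝ, ℂ)`. [folklore] -/
theorem continuous_timeShiftPath (s : ℝ) : Continuous (timeShiftPath s) := by
  refine ContinuousMap.continuous_of_continuous_uncurry _ ?_
  change Continuous fun p : C(ℝ, ℂ) × ℝ ↦ p.1 (s + p.2)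
  fun_prop

/-- The time shift is Borel measurable. [folklore] -/
theorem measurable_timeShiftPath (s : ℝ) : Measurable (timeShiftPath s) :=
  (continuous_timeShiftPath s).measurable

/-- **Space translation** of a two-sided path, `translatePath z γ = z + γ` — Zhan's `ℛ_Γ : (γ, z) ↦
(z + γ, z)` (first component). [cite: Zhan2021SLELoopMeasures, proof of Cor. 4.7] -/
def translatePath (z : ℂ) (γ : C(ℝ, ℂ)) : C(ℝ, ℂ) where
  toFun t := γ t + z
  continuous_toFun := γ.continuous.add continuous_const

/-- Value of a translated path. [folklore] -/
@[simp] theorem translatePath_apply (z : ℂ) (γ : C(ℝ, ℂ)) (t : ℝ) :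
    translatePath z γ t = γ t + z := rfl

/-- Translating by `0` is the identity. [folklore] -/
@[simp] theorem translatePath_zero (γ : C(ℝ, ℂ)) : translatePath 0 γ = γ := by
  ext t; simp

/-- Translations compose additively. [folklore] -/
theorem translatePath_translatePath (z w : ℂ) (γ : C(ℝ, ℂ)) :
    translatePath z (translatePath w γ) = translatePath (w + z) γ := by
  ext t; simp [add_assoc]

/-- Translation is jointly continuous in the path and the vector. [folklore] -/
theorem continuous_translatePath₂ : Continuous fun p : C(ℝ, ℂ) × ℂ ↦ translatePath p.2 p.1 := by
  refine ContinuousMap.continuous_of_continuous_uncurry _ ?_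
  change Continuous fun q : (C(ℝ, ℂ) × ℂ) × ℝ ↦ q.1.1 q.2 + q.1.2
  fun_prop

/-- Translation by a fixed vector is continuous. [folklore] -/
theorem continuous_translatePath (z : ℂ) : Continuous (translatePath z) :=
  continuous_translatePath₂.comp (Continuous.prodMk_left z)

/-- Translation is jointly Borel measurable (the path space is second countable, so the Borel
σ-algebra of `C(ℝ, ℂ) × ℂ` is the product σ-algebra). [folklore] -/
theorem measurable_translatePath₂ : Measurable fun p : C(ℝ, ℂ) × ℂ ↦ translatePath p.2 p.1 :=
  continuous_translatePath₂.measurable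

/-- Translation by a fixed vector is Borel measurable. [folklore] -/
theorem measurable_translatePath (z : ℂ) : Measurable (translatePath z) :=
  (continuous_translatePath z).measurable

/-- **The key pointwise identity** (Zhan's computation
`𝒯_* ∘ ℛ_Γ (γ, z) = (z + γ, z + 𝒫(γ)(1))`, i.e. `ℛ_Γ⁻¹ ∘ 𝒯_* ∘ ℛ_Γ ∘ ℛ_ℂ (γ, z) = (γ - 𝒫(γ)(1), z)`):
shifting the translated path is translating the re-rooted path by the shifted root,
`timeShiftPath s (z + γ) = (z + γ(s)) + reroot s γ`. [cite: Zhan2021SLELoopMeasures, proof of Cor. 4.7] -/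
theorem timeShiftPath_translatePath (s : ℝ) (z : ℂ) (γ : C(ℝ, ℂ)) :
    timeShiftPath s (translatePath z γ) = translatePath (z + γ s) (reroot s γ) := by
  ext t
  simp only [timeShiftPath_apply, translatePath_apply, reroot_apply]
  ring

/-- Un-rooting a translated path: `reroot 0 (z + γ) = reroot 0 γ` (`= γ` when `γ 0 = 0`). [folklore] -/
theorem reroot_zero_translatePath (z : ℂ) (γ : C(ℝ, ℂ)) :
    reroot 0 (translatePath z γ) = reroot 0 γ := by
  ext t
  simp only [reroot_apply, translatePath_apply]
  ring

/-- A re-rooted path is rooted at `0`: `(reroot s γ) 0 = 0`. [folklore] -/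
@[simp] theorem reroot_apply_zero (s : ℝ) (γ : C(ℝ, ℂ)) : reroot s γ 0 = 0 := by
  simp [reroot_apply]

end PathMaps

/-! ### The Lebesgue smear of a law on two-sided paths -/

section Smear

/-- **The Lebesgue smear** of a measure `μ` on two-sided paths: the push-forward of `μ ⊗ m²`
(`m²` = Lebesgue measure on `ℂ`) under `(γ, z) ↦ z + γ` — the law `μ` re-based at a Lebesgue-random
root. For `μ = ν̂^#` (two-sided whole-plane SLE_κ in its natural parametrisation rooted at `0`) this is
Zhan's `ℛ_Γ(ν^#_{∞⇌0} ⊗ m²) = ν^#_{∞⇌z}(dγ) ⊗ m²(dz)` read in the Minkowski content parametrisation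
based at the marked point, which Thm 4.1 (iv) identifies with the rooted SLE loop measure
`μ¹_∞(dγ) ⊗ ℳ_γ(dz)`. [cite: Zhan2021SLELoopMeasures, proof of Cor. 4.7] -/
def lebesgueSmear (μ : Measure C(ℝ, ℂ)) : Measure C(ℝ, ℂ) :=
  (μ.prod (volume : Measure ℂ)).map fun p ↦ translatePath p.2 p.1

/-- **Zhan's shear `ℛ_ℂ`**: `(γ, z) ↦ (reroot s γ, z + γ(s))` transports `μ ⊗ m²` to
`(reroot s)_* μ ⊗ m²` (translation invariance of Lebesgue measure, fibrewise).
[cite: Zhan2021SLELoopMeasures, proof of Cor. 4.7] -/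
theorem measurePreserving_rerootShear (μ : Measure C(ℝ, ℂ)) [SFinite μ] (s : ℝ) :
    MeasurePreserving (fun p : C(ℝ, ℂ) × ℂ ↦ (reroot s p.1, p.2 + p.1 s)) (μ.prod volume)
      ((μ.map (reroot s)).prod volume) := by
  refine MeasurePreserving.skew_product (f := reroot s) (g := fun γ z ↦ z + γ s)
    ⟨measurable_reroot s, rfl⟩ ?_ (Eventually.of_forall fun γ ↦ map_add_right_eq_self volume (γ s))
  exact measurable_snd.add ((continuous_eval_const s).measurable.comp measurable_fst)

/-- **Shifting the smear re-roots the law**: `(lebesgueSmear μ).map (timeShiftPath s) =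
lebesgueSmear (μ.map (reroot s))` — Zhan's "`ν^#_{∞⇌0} ⊗ m²` is invariant under
`ℛ_Γ⁻¹ ∘ 𝒯_* ∘ ℛ_Γ ∘ ℛ_ℂ = (γ, z) ↦ (γ - 𝒫(γ)(1), z)`", unconditionally and for every law.
[cite: Zhan2021SLELoopMeasures, proof of Cor. 4.7] -/
theorem lebesgueSmear_map_timeShiftPath (μ : Measure C(ℝ, ℂ)) [SFinite μ] (s : ℝ) :
    (lebesgueSmear μ).map (timeShiftPath s) = lebesgueSmear (μ.map (reroot s)) := by
  rw [lebesgueSmear, lebesgueSmear, Measure.map_map (measurable_timeShiftPath s) measurable_translatePath₂]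
  have hcomp : (timeShiftPath s ∘ fun p : C(ℝ, ℂ) × ℂ ↦ translatePath p.2 p.1) =
      (fun p : C(ℝ, ℂ) × ℂ ↦ translatePath p.2 p.1) ∘
        fun p : C(ℝ, ℂ) × ℂ ↦ (reroot s p.1, p.2 + p.1 s) := by
    funext p
    exact timeShiftPath_translatePath s p.2 p.1
  rw [hcomp, ← Measure.map_map measurable_translatePath₂ (measurePreserving_rerootShear μ s).measurable,
    (measurePreserving_rerootShear μ s).map_eq]

/-- The smear is translation invariant: `(lebesgueSmear μ).map (translatePath w) = lebesgueSmear μ`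
(Zhan: `ν^#_{∞⇌z} ⊗ m²` is `ℛ_Γ` of a product with Lebesgue measure). [cite: Zhan2021SLELoopMeasures, proof of Cor. 4.7] -/
theorem lebesgueSmear_map_translatePath (μ : Measure C(ℝ, ℂ)) [SFinite μ] (w : ℂ) :
    (lebesgueSmear μ).map (translatePath w) = lebesgueSmear μ := by
  rw [lebesgueSmear, Measure.map_map (measurable_translatePath w) measurable_translatePath₂]
  have hshear : MeasurePreserving (fun p : C(ℝ, ℂ) × ℂ ↦ (p.1, p.2 + w)) (μ.prod volume)
      (μ.prod volume) := by
    have h := MeasurePreserving.skew_product (μa := μ) (μc := (volume : Measure ℂ)) (f := id)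
      (g := fun (_ : C(ℝ, ℂ)) (z : ℂ) ↦ z + w) (MeasurePreserving.id μ)
      (measurable_snd.add measurable_const) (Eventually.of_forall fun _ ↦ map_add_right_eq_self volume w)
    simpa using h
  have hcomp : (translatePath w ∘ fun p : C(ℝ, ℂ) × ℂ ↦ translatePath p.2 p.1) =
      (fun p : C(ℝ, ℂ) × ℂ ↦ translatePath p.2 p.1) ∘ fun p : C(ℝ, ℂ) × ℂ ↦ (p.1, p.2 + w) := by
    funext p
    exact translatePath_translatePath w p.2 p.1
  rw [hcomp, ← Measure.map_map measurable_translatePath₂ hshear.measurable, hshear.map_eq]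

/-- Almost every point of `μ ⊗ m²` has a first coordinate rooted at `0` when `μ`-a.e. path is. [folklore] -/
theorem ae_prod_volume_apply_zero {μ : Measure C(ℝ, ℂ)} [SFinite μ] (h0 : ∀ᵐ γ ∂μ, γ 0 = 0) :
    ∀ᵐ p ∂(μ.prod (volume : Measure ℂ)), (p : C(ℝ, ℂ) × ℂ).1 0 = 0 := by
  rw [ae_iff] at h0 ⊢
  have hset : {p : C(ℝ, ℂ) × ℂ | ¬p.1 0 = 0} = {γ : C(ℝ, ℂ) | ¬γ 0 = 0} ×ˢ (univ : Set ℂ) := by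
    ext p; simp
  rw [hset, Measure.prod_prod, h0, zero_mul]

/-- **Un-smearing** (Zhan's `ℛ_Γ⁻¹`): on laws carried by paths rooted at `0`, `μ ⊗ m²` is recovered
from the smear by `γ̃ ↦ (γ̃ - γ̃(0), γ̃(0)) = (reroot 0 γ̃, γ̃ 0)`.
[cite: Zhan2021SLELoopMeasures, proof of Cor. 4.7] -/
theorem prod_volume_eq_lebesgueSmear_map (μ : Measure C(ℝ, ℂ)) [SFinite μ]
    (h0 : ∀ᵐ γ ∂μ, γ 0 = 0) :
    μ.prod (volume : Measure ℂ) = (lebesgueSmear μ).map fun γ ↦ (reroot 0 γ, γ 0) := by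
  have hD : Measurable fun γ : C(ℝ, ℂ) ↦ (reroot 0 γ, γ 0) :=
    (measurable_reroot 0).prodMk (continuous_eval_const (0 : ℝ)).measurable
  rw [lebesgueSmear, Measure.map_map hD measurable_translatePath₂]
  have hae : ((fun γ : C(ℝ, ℂ) ↦ (reroot 0 γ, γ 0)) ∘ fun p : C(ℝ, ℂ) × ℂ ↦ translatePath p.2 p.1)
      =ᵐ[μ.prod volume] id := by
    filter_upwards [ae_prod_volume_apply_zero h0] with p hp
    simp only [Function.comp_apply, id_eq, reroot_zero_translatePath, translatePath_apply, hp, zero_add]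
    rw [reroot_zero_of_apply_zero hp]
  rw [Measure.map_congr hae, Measure.map_id]

/-- Cancelling the Lebesgue factor: `μ ⊗ m² = ν ⊗ m²` forces `μ = ν`. [folklore] -/
theorem eq_of_prod_volume_eq {μ ν : Measure C(ℝ, ℂ)} [SFinite μ] [SFinite ν]
    (h : μ.prod (volume : Measure ℂ) = ν.prod volume) : μ = ν := by
  ext A hA
  have hB0 : (volume : Measure ℂ) (Metric.ball (0 : ℂ) 1) ≠ 0 :=
    (Metric.measure_ball_pos volume (0 : ℂ) one_pos).ne'
  have hBtop : (volume : Measure ℂ) (Metric.ball (0 : ℂ) 1) ≠ ∞ := measure_ball_lt_top.ne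
  have := congrArg (fun m : Measure (C(ℝ, ℂ) × ℂ) ↦ m (A ×ˢ Metric.ball (0 : ℂ) 1)) h
  simp only [Measure.prod_prod] at this
  exact (ENNReal.mul_left_inj hB0 hBtop).1 this

/-- The smear determines the law among laws carried by paths rooted at `0`. [folklore] -/
theorem eq_of_lebesgueSmear_eq {μ ν : Measure C(ℝ, ℂ)} [SFinite μ] [SFinite ν]
    (hμ : ∀ᵐ γ ∂μ, γ 0 = 0) (hν : ∀ᵐ γ ∂ν, γ 0 = 0) (h : lebesgueSmear μ = lebesgueSmear ν) :
    μ = ν :=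
  eq_of_prod_volume_eq (by rw [prod_volume_eq_lebesgueSmear_map μ hμ,
    prod_volume_eq_lebesgueSmear_map ν hν, h])

/-- A re-rooted law is carried by paths rooted at `0`. [folklore] -/
theorem ae_map_reroot_apply_zero (μ : Measure C(ℝ, ℂ)) (s : ℝ) :
    ∀ᵐ γ ∂(μ.map (reroot s)), γ 0 = 0 :=
  (ae_map_iff (measurable_reroot s).aemeasurable
    ((continuous_eval_const (0 : ℝ)).measurable (measurableSet_singleton (0 : ℂ)))).2
    (Eventually.of_forall fun γ ↦ reroot_apply_zero s γ)

/-- **Stationary increments ⟺ shift invariance of the Lebesgue smear** (the un-rooting argument of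
the proof of Zhan (2021), Cor. 4.7, as an equivalence): for an s-finite measure `μ` on two-sided
paths carried by paths rooted at `0`, the law is invariant under re-rooting by natural length `s`
(`𝒯_s : γ̂ ↦ γ̂(s + ·) - γ̂(s)`) iff its Lebesgue smear is invariant under the time shift
`γ̃ ↦ γ̃(s + ·)`. [cite: Zhan2021SLELoopMeasures, proof of Cor. 4.7] -/
theorem map_reroot_eq_self_iff_lebesgueSmear (μ : Measure C(ℝ, ℂ)) [SFinite μ]
    (h0 : ∀ᵐ γ ∂μ, γ 0 = 0) (s : ℝ) :
    μ.map (reroot s) = μ ↔ (lebesgueSmear μ).map (timeShiftPath s) = lebesgueSmear μ := by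
  rw [lebesgueSmear_map_timeShiftPath]
  refine ⟨fun h ↦ by rw [h], fun h ↦ ?_⟩
  exact eq_of_lebesgueSmear_eq (ae_map_reroot_apply_zero μ s) h0 h

/-- **Re-rooting stationarity ⟺ shift stationarity of the smear**, all `s` at once. [cite: Zhan2021SLELoopMeasures, proof of Cor. 4.7] -/
theorem isRerootInvariant_iff_lebesgueSmear (μ : Measure C(ℝ, ℂ)) [SFinite μ]
    (h0 : ∀ᵐ γ ∂μ, γ 0 = 0) :
    IsRerootInvariant μ ↔ ∀ s : ℝ, (lebesgueSmear μ).map (timeShiftPath s) = lebesgueSmear μ :=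
  forall_congr' fun s ↦ map_reroot_eq_self_iff_lebesgueSmear μ h0 s

/-- **Zhan's proof of Cor. 4.7, assembled modulo its two SLE inputs**: a law on two-sided paths that
is self-similar of some index (first half of Cor. 4.7), carried by paths rooted at `0`, and whose
Lebesgue smear is invariant under the unit time shift (for `ν̂^#`: Thm 4.1 (iv) and Rem. 2.4 read in
the natural parametrisation) has stationary increments — Step 1
(`isRerootInvariant_of_isSelfSimilar_of_map_reroot_one`) after the un-rooting equivalence at `s = 1`.
[cite: Zhan2021SLELoopMeasures, Cor. 4.7] -/
theorem isRerootInvariant_of_isSelfSimilar_of_lebesgueSmear {ν : ℝ} {μ : Measure C(ℝ, ℂ)} [SFinite μ]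
    (hss : IsSelfSimilar ν μ) (h0 : ∀ᵐ γ ∂μ, γ 0 = 0)
    (h1 : (lebesgueSmear μ).map (timeShiftPath 1) = lebesgueSmear μ) : IsRerootInvariant μ :=
  isRerootInvariant_of_isSelfSimilar_of_map_reroot_one hss h0
    ((map_reroot_eq_self_iff_lebesgueSmear μ h0 1).2 h1)

/-! ### Time smears: Zhan's `μ¹_∞(dγ) ⊗ ℳ_γ(dz)` in the natural parametrisation -/

/-- The time shift is jointly continuous in the path and the time. [folklore] -/
theorem continuous_timeShiftPath₂ : Continuous fun p : C(ℝ, ℂ) × ℝ ↦ timeShiftPath p.2 p.1 := by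
  refine ContinuousMap.continuous_of_continuous_uncurry _ ?_
  change Continuous fun q : (C(ℝ, ℂ) × ℝ) × ℝ ↦ q.1.1 (q.1.2 + q.2)
  fun_prop

/-- The time shift is jointly Borel measurable. [folklore] -/
theorem measurable_timeShiftPath₂ : Measurable fun p : C(ℝ, ℂ) × ℝ ↦ timeShiftPath p.2 p.1 :=
  continuous_timeShiftPath₂.measurable

/-- **The time smear** of a measure `M` on two-sided paths: `∫_ℝ (timeShiftPath t)_* M dt`, the
push-forward of `M ⊗ Leb_ℝ` under `(γ, t) ↦ γ(t + ·)`. This is Zhan's `μ¹_∞(dγ) ⊗ ℳ_γ(dz)` (rooted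
SLE loop measure at `∞`, marked by its Minkowski content measure) read in the natural
parametrisation based at the marked point, for `M = 𝒫_* μ¹_∞` (any measurable choice of time origin
on each loop): by Rem. 2.4 the natural parametrisation `γ̂ = 𝒫(γ)` is an isomorphism modulo null sets
between `(ℝ, Leb)` and `(γ, ℳ_γ)`, and re-basing `γ̂` at the marked point `z = γ̂(t)` is the time
shift `γ̂(t + ·)`. [cite: Zhan2021SLELoopMeasures, proof of Cor. 4.7 / Rem. 2.4] -/
def timeSmear (M : Measure C(ℝ, ℂ)) : Measure C(ℝ, ℂ) :=
  (M.prod (volume : Measure ℝ)).map fun p ↦ timeShiftPath p.2 p.1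

/-- **Time smears are shift invariant** — Zhan's "since `γ̂` induces an isomorphism modulo zero
between `(ℝ, m)` and `(γ, ℳ_γ)`, and `m` is invariant under translation, `ℳ_γ` is invariant under
`𝒯_γ`. Thus `μ¹_∞(dγ) ⊗ ℳ_γ(dz)` is invariant under `𝒯_* : (γ, z) ↦ (γ, 𝒯_γ(z))`", for every shift
`s` (translation invariance of Lebesgue measure on `ℝ`, fibrewise). [cite: Zhan2021SLELoopMeasures, proof of Cor. 4.7] -/
theorem timeSmear_map_timeShiftPath (M : Measure C(ℝ, ℂ)) [SFinite M] (s : ℝ) :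
    (timeSmear M).map (timeShiftPath s) = timeSmear M := by
  rw [timeSmear, Measure.map_map (measurable_timeShiftPath s) measurable_timeShiftPath₂]
  have hshear : MeasurePreserving (fun p : C(ℝ, ℂ) × ℝ ↦ (p.1, p.2 + s)) (M.prod volume)
      (M.prod volume) := by
    have h := MeasurePreserving.skew_product (μa := M) (μc := (volume : Measure ℝ)) (f := id)
      (g := fun (_ : C(ℝ, ℂ)) (t : ℝ) ↦ t + s) (MeasurePreserving.id M)
      (measurable_snd.add measurable_const) (Eventually.of_forall fun _ ↦ map_add_right_eq_self volume s)
    simpa using h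
  have hcomp : (timeShiftPath s ∘ fun p : C(ℝ, ℂ) × ℝ ↦ timeShiftPath p.2 p.1) =
      (fun p : C(ℝ, ℂ) × ℝ ↦ timeShiftPath p.2 p.1) ∘ fun p : C(ℝ, ℂ) × ℝ ↦ (p.1, p.2 + s) := by
    funext p
    exact timeShiftPath_timeShiftPath s p.2 p.1
  rw [hcomp, ← Measure.map_map measurable_timeShiftPath₂ hshear.measurable, hshear.map_eq]

/-- **Zhan's proof of Cor. 4.7 (stationary increments), assembled modulo Thm 4.1 (iv)**: if the
Lebesgue smear of a law `μ` carried by paths rooted at `0` is a multiple of a time smear — for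
`μ = ν̂^#` this is the rooted SLE loop measure decomposition
`μ¹_∞(dγ) ⊗ ℳ_γ(dz) = ν^#_{∞⇌z}(dγ) ⊗ m²(dz)` (Thm 4.1 (iv)) read in the natural parametrisation,
with `M = 𝒫_* μ¹_∞` — then `μ` is invariant under every re-rooting `reroot s` (the printed proof runs
this for `s = 1` and gets the other `s` from self-similarity; the argument is the same for every `s`,
so self-similarity is not needed here). [cite: Zhan2021SLELoopMeasures, Cor. 4.7] -/
theorem isRerootInvariant_of_lebesgueSmear_eq_timeSmear {μ M : Measure C(ℝ, ℂ)} [SFinite μ]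
    [SFinite M] {c : ℝ≥0∞} (h0 : ∀ᵐ γ ∂μ, γ 0 = 0) (hM : lebesgueSmear μ = c • timeSmear M) :
    IsRerootInvariant μ :=
  (isRerootInvariant_iff_lebesgueSmear μ h0).2 fun s ↦ by
    rw [hM, Measure.map_smul, timeSmear_map_timeShiftPath]

end Smear

/-! ### Specialisation to the two-sided whole-plane SLE_κ natural law -/

section SLE

/-- For a two-sided whole-plane SLE_κ natural law (corrected class), invariance under Zhan's `𝒯₁`
is exactly invariance of its Lebesgue smear — `ν^#_{∞⇌z}(dγ) ⊗ m²(dz)` in the natural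
parametrisation based at `z` — under the unit time shift, which is where Thm 4.1 (iv)
(`= μ¹_∞(dγ) ⊗ ℳ_γ(dz)`) and the `𝒯_γ`-invariance of `ℳ_γ` enter the printed proof.
[cite: Zhan2021SLELoopMeasures, proof of Cor. 4.7] -/
theorem IsTwoSidedWholePlaneSLENatLawMeas.map_reroot_one_iff_lebesgueSmear {κ : ℝ≥0}
    {μ : Measure C(ℝ, ℂ)} (h : IsTwoSidedWholePlaneSLENatLawMeas κ μ) :
    μ.map (reroot 1) = μ ↔ (lebesgueSmear μ).map (timeShiftPath 1) = lebesgueSmear μ := by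
  haveI := h.isProbabilityMeasure
  exact map_reroot_eq_self_iff_lebesgueSmear μ h.ae_apply_zero 1

/-- The same equivalence for the un-corrected class `IsTwoSidedWholePlaneSLENatLaw` (its laws are
also probability measures carried by rooted paths). [cite: Zhan2021SLELoopMeasures, proof of Cor. 4.7] -/
theorem IsTwoSidedWholePlaneSLENatLaw.map_reroot_one_iff_lebesgueSmear {κ : ℝ≥0}
    {μ : Measure C(ℝ, ℂ)} (h : IsTwoSidedWholePlaneSLENatLaw κ μ) :
    μ.map (reroot 1) = μ ↔ (lebesgueSmear μ).map (timeShiftPath 1) = lebesgueSmear μ := by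
  haveI := h.isProbabilityMeasure
  exact map_reroot_eq_self_iff_lebesgueSmear μ h.ae_apply_zero 1

/-- **Cor. 4.7 (stationary increments) for the corrected class, modulo its SLE inputs**: a
two-sided whole-plane SLE_κ natural law that is self-similar (Cor. 4.7, first half) and whose
Lebesgue smear is shift invariant (Thm 4.1 (iv) and Rem. 2.4 in the natural parametrisation) is invariant
under every re-rooting `reroot s`. What remains for the named fact is to supply `hss` and `h1` from
the SLE loop measure. [cite: Zhan2021SLELoopMeasures, Cor. 4.7] -/
theorem IsTwoSidedWholePlaneSLENatLawMeas.isRerootInvariant_of_lebesgueSmear {κ : ℝ≥0}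
    {μ : Measure C(ℝ, ℂ)} (h : IsTwoSidedWholePlaneSLENatLawMeas κ μ) {ν : ℝ}
    (hss : IsSelfSimilar ν μ) (h1 : (lebesgueSmear μ).map (timeShiftPath 1) = lebesgueSmear μ) :
    IsRerootInvariant μ := by
  haveI := h.isProbabilityMeasure
  exact isRerootInvariant_of_isSelfSimilar_of_lebesgueSmear hss h.ae_apply_zero h1

/-- **Cor. 4.7 (stationary increments) for the corrected class, modulo Thm 4.1 (iv) alone**: if the
Lebesgue smear of a two-sided whole-plane SLE_κ natural law `μ` (`ν^#_{∞⇌z}(dγ) ⊗ m²(dz)` in the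
natural parametrisation) is a multiple of a time smear (`μ¹_∞(dγ) ⊗ ℳ_γ(dz)` in the natural
parametrisation, Thm 4.1 (iv) with Rem. 2.4 and Lemma 2.12), then `μ` is invariant under every
re-rooting by natural length. The hypothesis `hM` is the one remaining input of the named fact
(the rooted SLE loop measure `μ¹_∞` is not constructed in the tree). [cite: Zhan2021SLELoopMeasures, Cor. 4.7] -/
theorem IsTwoSidedWholePlaneSLENatLawMeas.isRerootInvariant_of_timeSmear {κ : ℝ≥0}
    {μ : Measure C(ℝ, ℂ)} (h : IsTwoSidedWholePlaneSLENatLawMeas κ μ) {M : Measure C(ℝ, ℂ)}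
    [SFinite M] {c : ℝ≥0∞} (hM : lebesgueSmear μ = c • timeSmear M) : IsRerootInvariant μ := by
  haveI := h.isProbabilityMeasure
  exact isRerootInvariant_of_lebesgueSmear_eq_timeSmear h.ae_apply_zero hM

end SLE

end Literature.Probability.RandomPlanarGeometry
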